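import Mathlib.Tactic.Linarith
import Mathlib.Tactic.NormNum
import Summits.Ventures.CertifiedManyBodySolver.Downfold.PhaseMapOrdering
import Summits.Ventures.CertifiedManyBodySolver.Downfold.WorkedExamplePass

/-!
# The §14 worked-example PASS criteria, part 2: PASS-TV2 — the LSCO dome (ACCEPTANCE §6.2), STAGE 1 and the
# three-valued 09-09 stage, as total functions over the scorers' per-material quantities

Venture CertifiedManyBodySolver, cell `pub/hubbard-downfold`, seat hubbard-downfold-score-2 (session g5);
namespace `Summit.Ventures.CertifiedManyBodySolver.Downfold.WorkedExample` (part 1 = `WorkedExamplePass`: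
PASS-TV1 H₃S, PASS-TV3 LK-99/Cu, the `Pass` word). Everything here is PROVED and finite; nothing is about a
material. REUSED kernel objects of the second engine (score-1): `CellScore.Kind` (§4.5), `CellScore.Member` /
`pairClass` / `nClass` / `Member.inside` and the theorem `nClass_discordant_eq_zero_of_forall_inside` (§4.6,
`PhaseMapOrdering`); the router outcome is `RouterScore.Outcome` (score-2, `RouterWordScore`). The layer of
record it mirrors is `validation/score/regression/v1/tv_criteria.py` (hubbard-downfold-score-2, sha16 140991c6,
which applies §4.6's truth-separability exactly as `pairClass` does).

WHAT THIS IS NOT: not a scorer of record, not a certification of any cell, not physics, no new number.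

* STAGE 1 (`stage1`, «TODAY-PASS» of v1.0): all six inputs W-clean ∧ delivered ∧ router AGREE ∧ H1/H2 clean.
  It reads nothing else — in particular NOT the verdict kinds and NOT annex rows that raise no H incident
  (`Input.stage1ok_withKind`): this is why the first certified box-level rows of run-2026-08-26e (four energy
  windows, M50's T_c ceiling) left STAGE 1 at PASS while changing no cell. One H incident, one rejected input or
  one router word outside the expected set fails it (`stage1_eq_FAIL_of_*`).
* 09-09 (`stage2`, three-valued): FAIL unless the STAGE-1 prerequisites hold; else any false clause ⇒ FAIL,
  else any undecidable clause ⇒ NOT_YET, else PASS (`combine`), over the clauses «kinds = NOT,SC,SC,SC,SC,NOT»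
  (`kindsClause`: FP/FN ⇒ false; an ABSTAIN ⇒ undecidable), «no DISCORDANT pair among the four SC inputs»,
  «band(0.15) above band(0.07) CONCORDANT» (undecidable without both bands), «INSIDE ≥ 3 of 4» (undecidable
  with < 3 bands). Consequences: FP or FN anywhere ⇒ FAIL (`stage2_eq_FAIL_of_FP_or_FN`, S14); an ABSTAIN
  anywhere ⇒ never PASS (`stage2_ne_PASS_of_ABSTAIN`; today = NOT_YET, `stage2_today`); a DISCORDANT pair ⇒
  FAIL (`stage2_eq_FAIL_of_discordant`, S13); INSIDE on every banded SC input already gives the no-DISCORDANT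
  clause (`noDiscordantClause_of_all_inside` — the two clauses are not independent); on the truth of record the
  §14 target dome PASSES and the mis-ordered dome FAILS (`stage2_domeTarget`, `stage2_domeWrong`).
-/

namespace Summit.Ventures.CertifiedManyBodySolver.Downfold

namespace WorkedExample

open CellScore

/-! ## §1 STAGE 1 -/

/-- One of the six LSCO inputs as the scorer reports it. [folklore] -/
structure Input where
  /-- W1–W8 clean (not rejected) -/
  wellFormed : Bool
  /-- the map was delivered at all -/
  present : Bool
  /-- §4.2 router-word outcome -/
  router : RouterScore.Outcome
  /-- number of H1/H2 incidents naming this map -/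
  hard : ℕ
  /-- §4.5 material verdict kind -/
  kind : Kind

/-- The six inputs in dome order x = 0, 0.07, 0.125, 0.15, 0.22, 0.30. [folklore] -/
structure Six where
  /-- M13 La₂CuO₄ (x = 0; known non-SC) -/
  m13 : Input
  /-- M14 x = 0.07 -/
  m14 : Input
  /-- M15 x = 0.125 (carries the certified annexes) -/
  m15 : Input
  /-- M16 x = 0.15 (optimum) -/
  m16 : Input
  /-- M17 x = 0.22 -/
  m17 : Input
  /-- M50 x = 0.30 (known non-SC, overdoped) -/
  m50 : Input

/-- the six inputs as a list, in dome order. [folklore] -/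
def Six.toList (s : Six) : List Input := [s.m13, s.m14, s.m15, s.m16, s.m17, s.m50]

/-- the six verdict kinds, in dome order. [folklore] -/
def Six.kinds (s : Six) : List Kind := s.toList.map Input.kind

/-- STAGE-1 per input: W-clean ∧ delivered ∧ router AGREE ∧ H1/H2 clean. [folklore] -/
def Input.stage1ok (i : Input) : Bool :=
  i.wellFormed && i.present && decide (i.router = RouterScore.Outcome.AGREE) && decide (i.hard = 0)

/-- `stage1ok` unfolded. [folklore] -/
theorem Input.stage1ok_iff (i : Input) : i.stage1ok = true ↔
    i.wellFormed = true ∧ i.present = true ∧ i.router = RouterScore.Outcome.AGREE ∧ i.hard = 0 := by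
  simp [Input.stage1ok, Bool.and_eq_true, and_assoc]

/-- an input with its verdict kind replaced. [folklore] -/
def Input.withKind (i : Input) (k : Kind) : Input := { i with kind := k }

/-- STAGE 1 IS BLIND TO THE VERDICT KIND (hence to anything — certified annex rows included — that changes neither
well-formedness, delivery, the router word nor the H count). [folklore] -/
theorem Input.stage1ok_withKind (i : Input) (k : Kind) : (i.withKind k).stage1ok = i.stage1ok := rfl

/-- PASS-TV2 STAGE 1: all six inputs pass `stage1ok`. [folklore] -/
def stage1 (s : Six) : Pass := if s.toList.all Input.stage1ok then .PASS else .FAIL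

/-- STAGE 1 is PASS iff every input passes `stage1ok` … [folklore] -/
theorem stage1_eq_PASS_iff (s : Six) : stage1 s = .PASS ↔ s.toList.all Input.stage1ok = true := by
  unfold stage1; split_ifs with h <;> simp [h]

/-- … i.e. iff every input is W-clean, delivered, router-AGREE and H-clean. [folklore] -/
theorem stage1_eq_PASS_iff' (s : Six) : stage1 s = .PASS ↔ ∀ i ∈ s.toList,
    i.wellFormed = true ∧ i.present = true ∧ i.router = RouterScore.Outcome.AGREE ∧ i.hard = 0 := by
  rw [stage1_eq_PASS_iff, List.all_eq_true]
  simp only [Input.stage1ok_iff]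

/-- STAGE 1 is never NOT_YET (two-valued). [folklore] -/
theorem stage1_ne_NOT_YET (s : Six) : stage1 s ≠ .NOT_YET := by
  unfold stage1; split_ifs <;> simp

/-- One H1/H2 incident on any of the six (e.g. a contradicted certified annex at x = 1/8, S10) fails STAGE 1.
[folklore] -/
theorem stage1_eq_FAIL_of_hard_pos {s : Six} {i : Input} (hi : i ∈ s.toList) (h : 0 < i.hard) :
    stage1 s = .FAIL := by
  unfold stage1
  split_ifs with ha
  · have := (List.all_eq_true.mp ha) i hi
    rw [Input.stage1ok_iff] at this
    omega
  · rfl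

/-- A rejected input (e.g. M15 with an annex lacking its own conditional_on, S48) fails STAGE 1. [folklore] -/
theorem stage1_eq_FAIL_of_not_wellFormed {s : Six} {i : Input} (hi : i ∈ s.toList) (h : i.wellFormed = false) :
    stage1 s = .FAIL := by
  unfold stage1
  split_ifs with ha
  · have := (List.all_eq_true.mp ha) i hi
    rw [Input.stage1ok_iff, h] at this
    exact absurd this.1 (by decide)
  · rfl

/-- A router word outside the expected set on any input fails STAGE 1. [folklore] -/
theorem stage1_eq_FAIL_of_router_ne {s : Six} {i : Input} (hi : i ∈ s.toList)
    (h : i.router ≠ RouterScore.Outcome.AGREE) : stage1 s = .FAIL := by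
  unfold stage1
  split_ifs with ha
  · have := (List.all_eq_true.mp ha) i hi
    rw [Input.stage1ok_iff] at this
    exact absurd this.2.2.1 h
  · rfl

/-- TODAY (runs #3/#4 of record: the six LSCO maps W-clean, delivered, router 1BH+3BE(+CI) AGREE, 0 H incidents;
kinds TN, ABSTAIN ×5): STAGE 1 PASS — regression S50/S51 «PASS-TV2-today PASS». [folklore] -/
def sixToday : Six :=
  ⟨⟨true, true, .AGREE, 0, .TN⟩, ⟨true, true, .AGREE, 0, .ABSTAIN⟩, ⟨true, true, .AGREE, 0, .ABSTAIN⟩,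
    ⟨true, true, .AGREE, 0, .ABSTAIN⟩, ⟨true, true, .AGREE, 0, .ABSTAIN⟩, ⟨true, true, .AGREE, 0, .ABSTAIN⟩⟩

/-- `sixToday` passes STAGE 1. [folklore] -/
theorem stage1_today : stage1 sixToday = .PASS := by decide

/-! ## §2 The 09-09 stage (three-valued) -/

/-- the 09-09 target kinds «material verdicts NOT, SC, SC, SC, SC, NOT» = TN, TP, TP, TP, TP, TN. [folklore] -/
def expectedKinds : List Kind := [.TN, .TP, .TP, .TP, .TP, .TN]

/-- the KINDS clause: `some false` if any input is FP or FN (a wrong decision is final), `some true` if the kinds are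
exactly the target, `none` otherwise (some input still ABSTAINs: not yet decidable). [folklore] -/
def kindsClause (ks : List Kind) : Option Bool :=
  if ks.any (fun k => decide (k = Kind.FP) || decide (k = Kind.FN)) then some false
  else if ks = expectedKinds then some true else none

/-- The four SC inputs' reference-column members (x = 0.07, 0.125, 0.15, 0.22) for the ordering and inside clauses;
`none` = the map carries no band at P = 0. [folklore] -/
structure Dome where
  /-- M14 x = 0.07 -/
  m14 : Option Member
  /-- M15 x = 0.125 -/
  m15 : Option Member
  /-- M16 x = 0.15 -/
  m16 : Option Member
  /-- M17 x = 0.22 -/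
  m17 : Option Member

/-- the banded members, in dome order. [folklore] -/
def Dome.members (d : Dome) : List Member := [d.m14, d.m15, d.m16, d.m17].reduceOption

/-- «no DISCORDANT pair among {0.07, 0.125, 0.15, 0.22}» (§4.6 classes over the banded members; vacuous while bands
are missing — the INSIDE clause is undecidable then, so vacuity never passes the stage). [folklore] -/
def noDiscordantClause (d : Dome) : Option Bool := some (decide (nClass .discordant d.members = 0))

/-- «band(x = 0.15) above band(x = 0.07) CONCORDANT»; undecidable unless both bands exist. [folklore] -/
def concordant1416Clause (d : Dome) : Option Bool :=
  match d.m14, d.m16 with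
  | some a, some b => some (decide (pairClass a b = .concordant))
  | _, _ => none

/-- «INSIDE ≥ 3 of 4 SC columns»; undecidable with fewer than three banded members. [folklore] -/
def insideClause (d : Dome) : Option Bool :=
  if d.members.length < 3 then none else some (decide (3 ≤ d.members.countP Member.inside))

/-- three-valued conjunction: any `some false` ⇒ FAIL; else any `none` ⇒ NOT_YET; else PASS. [folklore] -/
def combine (l : List (Option Bool)) : Pass :=
  if l.any (fun o => decide (o = some false)) then .FAIL
  else if l.any (fun o => decide (o = none)) then .NOT_YET else .PASS

/-- a false clause makes the conjunction FAIL. [folklore] -/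
theorem combine_eq_FAIL_of_mem {l : List (Option Bool)} (h : some false ∈ l) : combine l = .FAIL := by
  unfold combine
  have : l.any (fun o => decide (o = some false)) = true := List.any_eq_true.mpr ⟨_, h, by simp⟩
  simp [this]

/-- the conjunction is PASS iff every clause is `some true`. [folklore] -/
theorem combine_eq_PASS_iff {l : List (Option Bool)} : combine l = .PASS ↔ ∀ o ∈ l, o = some true := by
  unfold combine
  split_ifs with h1 h2
  · refine iff_of_false (by simp) fun h => ?_
    obtain ⟨o, ho, hof⟩ := List.any_eq_true.mp h1
    rw [decide_eq_true_eq] at hof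
    have := h o ho
    rw [hof] at this
    exact absurd this (by simp)
  · refine iff_of_false (by simp) fun h => ?_
    obtain ⟨o, ho, hon⟩ := List.any_eq_true.mp h2
    rw [decide_eq_true_eq] at hon
    have := h o ho
    rw [hon] at this
    exact absurd this (by simp)
  · refine iff_of_true (by simp) fun o ho => ?_
    rcases o with _ | _ | _
    · exact absurd (List.any_eq_true.mpr ⟨none, ho, by simp⟩) h2
    · exact absurd (List.any_eq_true.mpr ⟨some false, ho, by simp⟩) h1
    · rfl

/-- PASS-TV2 09-09 stage: FAIL unless the STAGE-1 prerequisites hold (`pre`), else the three-valued conjunction of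
the kinds / no-discordant / concordant(0.07, 0.15) / inside-3-of-4 clauses. [folklore] -/
def stage2 (pre : Bool) (ks : List Kind) (d : Dome) : Pass :=
  if pre = false then .FAIL
  else combine [kindsClause ks, noDiscordantClause d, concordant1416Clause d, insideClause d]

/-- with the prerequisites, `stage2` is the conjunction. [folklore] -/
theorem stage2_true (ks : List Kind) (d : Dome) :
    stage2 true ks d = combine [kindsClause ks, noDiscordantClause d, concordant1416Clause d, insideClause d] := by
  simp [stage2]

/-- an FP or an FN anywhere makes the kinds clause false … [folklore] -/
theorem kindsClause_eq_some_false {ks : List Kind} (h : Kind.FP ∈ ks ∨ Kind.FN ∈ ks) :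
    kindsClause ks = some false := by
  unfold kindsClause
  have : ks.any (fun k => decide (k = Kind.FP) || decide (k = Kind.FN)) = true := by
    rcases h with h | h
    · exact List.any_eq_true.mpr ⟨_, h, by simp⟩
    · exact List.any_eq_true.mpr ⟨_, h, by simp⟩
  simp [this]

/-- … an ABSTAIN anywhere keeps it from being true (the target has no ABSTAIN). [folklore] -/
theorem kindsClause_ne_some_true_of_ABSTAIN {ks : List Kind} (h : Kind.ABSTAIN ∈ ks) :
    kindsClause ks ≠ some true := by
  unfold kindsClause
  split_ifs with h1 h2
  · simp
  · exfalso
    rw [h2] at h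
    simp [expectedKinds] at h
  · simp

/-- 09-09 FAILS on any FP or FN among the six (S14: a band at x = 0.30 ⇒ FP ⇒ FAIL), prerequisites or not. [folklore] -/
theorem stage2_eq_FAIL_of_FP_or_FN {pre : Bool} {ks : List Kind} {d : Dome} (h : Kind.FP ∈ ks ∨ Kind.FN ∈ ks) :
    stage2 pre ks d = .FAIL := by
  cases pre
  · rfl
  · rw [stage2_true]
    exact combine_eq_FAIL_of_mem (by simp [kindsClause_eq_some_false h])

/-- 09-09 is NEVER PASS while any input ABSTAINs (today: five of six ⇒ NOT_YET or FAIL). [folklore] -/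
theorem stage2_ne_PASS_of_ABSTAIN {pre : Bool} {ks : List Kind} {d : Dome} (h : Kind.ABSTAIN ∈ ks) :
    stage2 pre ks d ≠ .PASS := by
  cases pre
  · exact fun h' => absurd h' (by simp [stage2])
  · rw [stage2_true]
    intro hc
    exact kindsClause_ne_some_true_of_ABSTAIN h ((combine_eq_PASS_iff.mp hc) _ (by simp))

/-- 09-09 FAILS on a DISCORDANT pair (S13). [folklore] -/
theorem stage2_eq_FAIL_of_discordant {ks : List Kind} {d : Dome} (h : nClass .discordant d.members ≠ 0) :
    stage2 true ks d = .FAIL := by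
  rw [stage2_true]
  exact combine_eq_FAIL_of_mem (by simp [noDiscordantClause, h])

/-- 09-09 FAILS without the STAGE-1 prerequisites (a rejected / missing / H-incident input). [folklore] -/
theorem stage2_false (ks : List Kind) (d : Dome) : stage2 false ks d = .FAIL := rfl

/-- §4.4 ⇒ §4.6 INSIDE THE DOME MEANS ORDERED: if all banded SC inputs are INSIDE their measured T_c the
no-DISCORDANT clause holds (score-1's `nClass_discordant_eq_zero_of_forall_inside`) — a dome reproduced inside the
bands cannot be mis-ordered. [folklore] -/
theorem noDiscordantClause_of_all_inside {d : Dome} (h : ∀ m ∈ d.members, m.inside = true) :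
    noDiscordantClause d = some true := by
  simp [noDiscordantClause, nClass_discordant_eq_zero_of_forall_inside h]

/-! ### The LSCO numbers of record (truth v1.x, P = 0: M14 12.5 ± 4.5 K, M15 29 ± 3 K, M16 38 ± 2 K, M17 26 ± 4 K
⇒ τ = 4.5, 3, 2, 4 K; the (x = 0.125, x = 0.22) pair is truth-INSEPARABLE, |29 − 26| ≤ 3 + 4) -/

/-- τ of the four SC columns is the curator's error bar. [folklore] -/
theorem tau_lsco : CellScore.tau (25 / 2) (9 / 2) = 9 / 2 ∧ CellScore.tau 29 3 = 3 ∧ CellScore.tau 38 2 = 2 ∧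
    CellScore.tau 26 4 = 4 := by
  norm_num [CellScore.tau]

/-- M14 of the §14 09-09 TARGET dome (regression S12): 12.5 ± 4.5 K, band [8, 17] K. [folklore] -/
def d14 : Member := ⟨25 / 2, 9 / 2, 8, 17⟩
/-- M15 of the target dome: 29 ± 3 K, band [25, 33]. [folklore] -/
def d15 : Member := ⟨29, 3, 25, 33⟩
/-- M16 of the target dome: 38 ± 2 K, band [35, 41]. [folklore] -/
def d16 : Member := ⟨38, 2, 35, 41⟩
/-- M17 of the target dome: 26 ± 4 K, band [22, 30]. [folklore] -/
def d17 : Member := ⟨26, 4, 22, 30⟩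
/-- M17 MIS-ORDERED (regression S13): band [45, 55] above the optimum's [35, 41]. [folklore] -/
def d17w : Member := ⟨26, 4, 45, 55⟩

/-- the target dome. [folklore] -/
def domeTarget : Dome := ⟨some d14, some d15, some d16, some d17⟩
/-- the mis-ordered dome. [folklore] -/
def domeWrong : Dome := ⟨some d14, some d15, some d16, some d17w⟩
/-- today's dome: no band at any SC input. [folklore] -/
def domeToday : Dome := ⟨none, none, none, none⟩

/-- the target dome's banded members. [folklore] -/
theorem domeTarget_members : domeTarget.members = [d14, d15, d16, d17] := rfl
/-- the mis-ordered dome's banded members. [folklore] -/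
theorem domeWrong_members : domeWrong.members = [d14, d15, d16, d17w] := rfl

/-- the target dome's six pairs: five CONCORDANT, (0.125, 0.22) OVERLAPPING (truth-inseparable). [folklore] -/
theorem domeTarget_pairs : pairClass d14 d15 = .concordant ∧ pairClass d14 d16 = .concordant ∧
    pairClass d14 d17 = .concordant ∧ pairClass d15 d16 = .concordant ∧ pairClass d15 d17 = .overlapping ∧
    pairClass d16 d17 = .concordant := by
  refine ⟨?_, ?_, ?_, ?_, ?_, ?_⟩ <;> norm_num [pairClass, separable, disjoint, lt_abs, d14, d15, d16, d17]

/-- the mis-ordered dome's pairs with M17: (0.15, 0.22) DISCORDANT, (0.07, 0.22) concordant, (0.125, 0.22)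
overlapping. [folklore] -/
theorem domeWrong_pairs : pairClass d16 d17w = .discordant ∧ pairClass d14 d17w = .concordant ∧
    pairClass d15 d17w = .overlapping := by
  refine ⟨?_, ?_, ?_⟩ <;> norm_num [pairClass, separable, disjoint, lt_abs, d14, d15, d16, d17w]

/-- all four target bands are INSIDE; the mis-ordered M17 band [45, 55] is not (45 − 4 > 26). [folklore] -/
theorem dome_inside : d14.inside = true ∧ d15.inside = true ∧ d16.inside = true ∧ d17.inside = true ∧
    d17w.inside = false := by
  norm_num [Member.inside, CellScore.inside, d14, d15, d16, d17, d17w]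

/-- target dome: 0 discordant pairs; mis-ordered dome: 1. [folklore] -/
theorem dome_nDiscordant : nClass .discordant [d14, d15, d16, d17] = 0 ∧ nClass .discordant [d14, d15, d16, d17w] = 1 := by
  constructor <;> simp [nClass, pairs, domeTarget_pairs, domeWrong_pairs]

/-- target dome: all four INSIDE. [folklore] -/
theorem domeTarget_nInside : [d14, d15, d16, d17].countP Member.inside = 4 := by
  simp [dome_inside]

/-- THE §14 09-09 TARGET PASSES: kinds NOT,SC,SC,SC,SC,NOT; 0 discordant; (0.07, 0.15) concordant; INSIDE 4/4
(regression S12 «PASS-TV2-0909 PASS»). [folklore] -/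
theorem stage2_domeTarget : stage2 true expectedKinds domeTarget = .PASS := by
  rw [stage2_true, combine_eq_PASS_iff]
  intro o ho
  simp only [List.mem_cons, List.not_mem_nil, or_false] at ho
  rcases ho with rfl | rfl | rfl | rfl
  · simp [kindsClause, expectedKinds]
  · rw [noDiscordantClause, domeTarget_members, dome_nDiscordant.1]; rfl
  · simp [concordant1416Clause, domeTarget, domeTarget_pairs]
  · rw [insideClause, domeTarget_members, domeTarget_nInside]; rfl

/-- THE MIS-ORDERED DOME FAILS: (0.15, 0.22) is DISCORDANT (regression S13). [folklore] -/
theorem stage2_domeWrong : stage2 true expectedKinds domeWrong = .FAIL := by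
  apply stage2_eq_FAIL_of_discordant
  rw [domeWrong_members, dome_nDiscordant.2]
  exact one_ne_zero

/-- TODAY (runs #3/#4: La₂CuO₄ TN by the CI default, the five doped inputs ABSTAIN, no band anywhere; STAGE-1
prerequisites met): NOT_YET — nothing false, nothing decidable yet (regression S50/S51 «TV2-09-09 NOT-YET»).
[folklore] -/
theorem stage2_today : stage2 true sixToday.kinds domeToday = .NOT_YET := by
  decide

/-- … and with an FP at x = 0.30 (S14: a band [5, 15] K on the overdoped non-superconductor) it FAILS at once,
bands or no bands. [folklore] -/
theorem stage2_fpOverdoped : stage2 true [.TN, .ABSTAIN, .ABSTAIN, .ABSTAIN, .ABSTAIN, .FP] domeToday = .FAIL :=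
  stage2_eq_FAIL_of_FP_or_FN (Or.inl (by simp))

end WorkedExample

end Summit.Ventures.CertifiedManyBodySolver.Downfold
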